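/-
Copyright (c) 2026 the pub-hodgecm-mathlib formalisation cell (harness21).  Prover seat hodgecm-mathlib-K2Liu-p05 (g5), Track B «K2-LIT»,
#184♮ = hLiu418 = `stmt-HodgeConjecture-24832`; #42S payer road, organ S1 (local Siegel–Weil spanning), ROAD W file F4a, part 1 (the WORDS)
(LEAD F0P6-plan (g14) RULING «M-158a» (5); census K2Liu-p05 (g4) 2026-09-04T10:29:14Z, heads K2Liu-p05 (g5) 11:02Z on `K2/STATUS.md`).
-/
import Summits.HodgeConjecture.HodgeConjecture.Theorems.K2LiuLocalSWSectionDefs           -- ★ D-A v1: `swSectionLoc`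
import Literature.NumberTheory.GelbartRogawski1991.LocalDoubledTwistedSectionUnipotentWord  -- ★ §1 generic unipotent word (unit scalar), mover, `detDelta_nElem`
import Literature.RepresentationTheory.HeisenbergGroup.SchrodingerSiegelFunctional          -- ★ `exists_apply_zero_comp_implementer_eq_mul`
import HarnessLib

/-!
# Crux `HLiu418`, #42S organ S1, ROAD W, file F4a (part 1): THE OPERATOR WORDS BEHIND THE BIG-CELL VALUE OF THE LOCAL SIEGEL–WEIL SECTION
# (change of `m₀` = one scalar; the exact unipotent word `Γ ω_D(n(t)) = n(c_t) Γ`; the Weyl word `ω_D(w_Δ) = γ • Γ⁻¹ 𝓕 m(B′) Γ`)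

Cell `hodgecm-mathlib`, crux item hLiu418 = `stmt-HodgeConjecture-24832`; squad K2 ∕ K2Liu; LEAD F0P6-plan (g14), organ lead K2Liu-p06 (g4);
prover K2Liu-p05 (g5).  THEOREMS ONLY (no `def`, no instance, no notation, no named-fact hypothesis, no `sorry`); lane
`--supports stmt-HodgeConjecture-24832 --as helper`.  Sequel: `K2LiuLocalSWBigCellFormula` (the value `F_Φ(w_Δ · n(t))` itself).

WHY.  ROAD W of organ S1 (`I_v(½, χ_v) = R₂(V⁺_v) + R₂(V⁻_v)`, census `K2/K2Liu-p06/g4/CENSUS-S1-LocalSWSpanning.K2Liu-p06-g4.md`, RULINGS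
«M-157t», «M-158a») reduces the spanning to ONE big-cell section with non-zero PROFILE `b ↦ F_Φ(w_Δ n(b))` (★ F2 `K2LiuLocalSWBigCellGeneration`,
★ F3 `K2LiuLocalSWBigCellLattice`), so every variant of the witness (W3) needs the value of the local Siegel–Weil section ★
`swSectionLoc v s m₀ Φ h = (ω(m₀ · s h) Φ)(0)` (D-A v1) on the big cell `P_Δ w_Δ N_Δ`.  This file supplies the three operator words, for the tree's
doubled local Weil datum at GENERIC `(n, T₀, J^𝔻)` (the standard doubled line, the K2Lit frame `T₀ := gramR …` and the TENSOR datum of record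
`T₀ := gramR L e′ dV hdV (tensorFrame …)` of the S1 face are all instances; no telescope is opened here).

SETTING (the binders of ★ `LocalDoubledSiegelUnipotentMover`, ★ `LocalDoubledTwistedSectionUnipotentWord` §1): `L` CM, `v` a finite place of `L⁺`,
Haar `μ` on `L⁺_v`, a real symmetric non-degenerate `T₀ ∈ M_n(L⁺)`, `J^𝔻 = (T₀ ⊕ −T₀) ⊗ L` (`hJD`), the doubled group `H_v = U(J^𝔻)(L⁺_v)`, its
Siegel unipotents `n(t)` (★ `nElem t ht`, adapted `[[1, t], [0, 1]]`), its Weyl element `w_Δ` (★ `weylDelta`, adapted `[[0, 1], [1, 0]]`), a local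
splitting DATUM `D` (★ `LocalSplittingDatum`: Rao section `r`, Kudla's `β`, `ω_D = β⁻¹ • r ∘ ι`, ★ `localOmega_apply`) on the Schrödinger model
`𝒮(L⁺_v^{n+n})`, and MOVER-IMPLEMENTERS: `E ∈ Sp(𝕎^𝔻_v)` with `E ℓ_Δ = ℓ_Y` and `Γ` implementing `E` (resp. `m₀ ∈ S̃p_ψ(𝕎^𝔻_v)` whose projection
is such a mover, `hm₀` — Rao's `r(δ′)`; the `m₀` OF RECORD `(δ_v, deltaImpl v)` of ★ `K2LiuSWSectionPlaceFactorisation` is one by ★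
`map_deltaLoc_deltaLagrangian`, the CAYLEY mover of ★ `exists_mover_conj_iotaD_weylDelta` another — the one whose conjugate of `w_Δ` is the one-sided word
`J_𝕋⁻¹ m(B′)`; the rational `δ` gives a two-sided word, ★ CayleyMover «WHY A NEW MOVER»).

* §0 abstract bookkeeping (`ω(m₀ · x)`, `ω(m₀ · s(w n))` over abstract carriers — no rewriting inside the telescope, as ★ #7b §0).
* §1 `chiDet_eq_one_of_detDelta_eq_one`; **`exists_apply_zero_moverChange_eq_mul`** — two mover-implementers differ on the `Δ`-functional by a
  scalar: `∃ κ, ∀ Ψ, (Γ′ (Γ⁻¹ Ψ))(0) = κ · Ψ(0)` (`Γ′ Γ⁻¹` implements `E′ E⁻¹ ∈ P_Y`; ★ `exists_apply_zero_comp_implementer_eq_mul`); hence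
  **`exists_swSectionLoc_moverChange`**: `F^{m₀′}_Φ(h) = κ · F^{m₀}_Φ(h)` with ONE `κ` for all `Φ, h` and ANY splitting `s` — ★ S1-F1 `localSWImage` is
  blind to the choice of `m₀` (the assembly may swap the `m₀` of record for a Cayley one).
* §2 **`implementer_localOmega_nElem_apply`** — THE EXACT UNIPOTENT WORD through ANY mover-implementer, generic `n`:
  `Γ (ω_D(n(t)) Ψ) = unipOpPi c_t (Γ Ψ)`, `c_t := cOfFix 𝕋 (E ι(n(t)) E⁻¹)` (multiplication by `ψ_v(−½⟨x, c_t x⟩)`; line law `c_{r•t} = r • c_t` is ★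
  `cOfFix_mover_conj_smul`), from ★ §1-generic `exists_section_iotaD_nElem_apply_eq_smul_conj_unipOpPi` (unit scalar) and the PARABOLIC NORMALISATION
  AT `n(t)` BY VALUE `hpar : (Γ (ω_D(n(t)) (Γ⁻¹ Φ)))(0) = Φ(0)` — discharged for the CM datum `localSplittingDatumCM` and ANY mover-implementer by
  **`parabolicAtUnipotents_localSplittingDatumCM`** (★ `localSplittingDatumCM_parabolic` + ★ `detDelta_nElem` + uniqueness of implementers up to scalars);
  the `n`-generic, `kronLoc`-free form of ★ `twistedSection_kronLoc_nElem_apply_eq_conj_unipOpPi`.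
* §3 **`exists_localOmega_weylDelta_apply_eq_smul`** — `ω_D(w_Δ) = γ • Γ⁻¹ ∘ 𝓕 ∘ leviOpPi B′ ∘ Γ` for a unit `γ`, given the Weyl conjugation
  `hW : E ι(w_Δ) E⁻¹ = J_𝕋⁻¹ m(B′)` (★ `leraySection_deltaLagrangian_apply_eq_smul_conj_fourierOpPi_leviOpPi`, `β(w_Δ)⁻¹` folded).
* §4 `exists_swSectionLoc_ne_zero` (`Φ ↦ F_Φ(h)` is never identically zero) and **`exists_ne_zero_swSectionLoc_moverChange`** (§1 with `κ ≠ 0`, the organ lead's letter).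
References: [Kudla1994] §3 Thm. 3.1; [Rangarao1993] Lemma 3.2 (3.8)–(3.9), Thm. 3.5; [MoeglinVignerasWaldspurger1987] Chap. 2 II.1 (A)–(B), II.6;
[Weil1964] n° 13 (16), (29); [HarrisKudlaSweet1996] §1 (1.15)–(1.16); [KudlaRallis1994] §1 (the section `Φ ↦ ω(h)Φ(0)`).
HONEST LABEL.  Count-neutral helper: `HC_CM` is proved only modulo the 7 printed citations (2 remaining named inputs: hLiu418 = `stmt-HodgeConjecture-24832`,
h413 = `stmt-HodgeConjecture-24833`) until rung 0 closes.
-/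

set_option autoImplicit false
set_option linter.dupNamespace false -- the mandated namespace repeats `HodgeConjecture.HodgeConjecture`

noncomputable section

open scoped Matrix
open NumberField IsDedekindDomain MeasureTheory MeasureTheory.Measure Matrix
open Literature.RepresentationTheory.HeisenbergGroup Literature.RepresentationTheory.HeisenbergGroup.SymplecticMatrix
open Literature.NumberTheory.Automorphic Literature.NumberTheory.Automorphic.UnitaryGroup Literature.NumberTheory.Weil1964
open Literature.NumberTheory.GaloisRepresentations Literature.NumberTheory.GaloisRepresentations.IsNonarchimedeanLocalField
open Literature.RepresentationTheory.HarrisKudlaSweet1996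
open Literature.NumberTheory.GelbartRogawski1991.UnitaryDualPair
open Literature.NumberTheory.GelbartRogawski1991.UnitaryDualPair.LocalSplitting
open Summit.HodgeConjecture.HodgeConjecture.Cruxes.HLiu418.K2LiuLocalSWSectionDefs

namespace Summit.HodgeConjecture.HodgeConjecture.Cruxes.HLiu418.K2LiuLocalSWBigCellWords

/-! ## §0 Abstract bookkeeping: a splitting `s : G →* M̃`, a representation `ω` of `M̃`

All group ∕ operator algebra is done here over ABSTRACT carriers, so that no rewriting with metavariable patterns ever happens inside the doubled
datum's telescope (the pattern of ★ #7b `K2LiuSiegelWeilSectionMem` §0); the heavy declarations below only instantiate these identities. -/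

section Abstract

variable {G Mp V : Type*} [Group G] [Group Mp] [AddCommMonoid V] [Module ℂ V]

/-- `ω(m₀ · x) Φ = ω(m₀) (ω(x) Φ)`. [cite: MoeglinVignerasWaldspurger1987, Chap. 2 II.1 (B)] -/
theorem rep_mul_apply (ω : Representation ℂ Mp V) (m₀ x : Mp) (Φ : V) : ω (m₀ * x) Φ = ω m₀ (ω x Φ) := by
  rw [map_mul, Module.End.mul_apply]

/-- `ω(m₀ · s(w n)) Φ = ω(m₀) (ω(s w) (ω(s n) Φ))` (`s` a homomorphism). [cite: MoeglinVignerasWaldspurger1987, Chap. 2 II.1 (B)] [cite: Kudla1994, §3 Thm. 3.1] -/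
theorem rep_mul_splitting_mul_apply (s : G →* Mp) (ω : Representation ℂ Mp V) (m₀ : Mp) (w n : G) (Φ : V) :
    ω (m₀ * s (w * n)) Φ = ω m₀ (ω (s w) (ω (s n) Φ)) := by
  rw [map_mul s, ← mul_assoc, map_mul ω, map_mul ω, Module.End.mul_apply, Module.End.mul_apply]

end Abstract

/-! ## §1 Two mover-implementers differ on the `Δ`-functional by a scalar -/

section Generic

variable (F : Type) [Field F] [NumberField F] (E : Type) [Field E] [NumberField E] [Algebra F E]
  [Algebra.IsQuadraticExtension F E] (c : E ≃ₐ[F] E) (v : HeightOneSpectrum (𝓞 F)) (n : ℕ)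
  {JD : Matrix (Fin (n + n)) (Fin (n + n)) E}

omit [Algebra.IsQuadraticExtension F E] in
/-- **`χ_v(det_Δ p) = 1` when `det_Δ p_w = 1` at every `w ∣ v`** (e.g. on the unipotent radical `N_Δ`, ★ `detDelta_nElem`).
[cite: HarrisKudlaSweet1996, §1 (1.15)–(1.16)] -/
theorem chiDet_eq_one_of_detDelta_eq_one (χv : ∀ w : UnitaryGroup.PlacesOver E v, (w.1.adicCompletion E)ˣ →* ℂˣ)
    (p : UnitaryGroup.localPi E c (n + n) JD v) (hp : ∀ w, detDelta F E c v n w p = 1) : chiDet F E c v n χv p = 1 := by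
  unfold chiDet
  refine Finset.prod_eq_one fun w _ => ?_
  split_ifs with hu
  · have h1 : hu.unit = 1 := Units.ext (by rw [IsUnit.unit_spec, hp w, Units.val_one])
    rw [h1, map_one]
  · rfl

variable (N : ℕ) (T : Matrix (Fin N) (Fin N) F) (hTv : IsUnit (localGram F N T v).det)

include hTv in
/-- **TWO MOVER-IMPLEMENTERS DIFFER ON THE `Δ`-FUNCTIONAL BY A SCALAR.**  If `E, E′ ∈ Sp(𝕎_v)` carry the same subspace `ℓ` onto the Lagrangian
`ℓ_Y = 0 × F_vᴺ` and `Γ, Γ′` implement them on the Schrödinger model `𝒮(F_vᴺ)`, then `∃ κ, ∀ Ψ, (Γ′ (Γ⁻¹ Ψ))(0) = κ · Ψ(0)`: `Γ′ Γ⁻¹` implements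
`E′ E⁻¹`, which stabilises `ℓ_Y`, and an implementer of a `P_Y`-element acts on evaluation at `0` by a scalar (★ `exists_apply_zero_comp_implementer_eq_mul`).
[cite: MoeglinVignerasWaldspurger1987, Chap. 2 II.1 (A), II.6] -/
theorem exists_apply_zero_moverChange_eq_mul
    (ℓ : Submodule (v.adicCompletion F) ((Fin N → v.adicCompletion F) × (Fin N → v.adicCompletion F)))
    (E₁ E₂ : LocalSp F N T v) (hE₁ : ℓ.map (toLin F v E₁) = lagrangianY F N v) (hE₂ : ℓ.map (toLin F v E₂) = lagrangianY F N v)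
    (Γ₁ Γ₂ : SchwartzBruhat (Fin N → v.adicCompletion F) ≃ₗ[ℂ] SchwartzBruhat (Fin N → v.adicCompletion F))
    (hΓ₁ : Implements (localSchrodinger F N T v) (ofSymplectic _ E₁) Γ₁) (hΓ₂ : Implements (localSchrodinger F N T v) (ofSymplectic _ E₂) Γ₂) :
    ∃ κ : ℂ, ∀ Ψ : SchwartzBruhat (Fin N → v.adicCompletion F),
      ((Γ₂ (Γ₁.symm Ψ) : SchwartzBruhat (Fin N → v.adicCompletion F)) : (Fin N → v.adicCompletion F) → ℂ) 0 =
        κ * ((Ψ : SchwartzBruhat (Fin N → v.adicCompletion F)) : (Fin N → v.adicCompletion F) → ℂ) 0 := by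
  have hψ := isContinuousNontrivial_adeleAddCharAt F v
  -- `Γ₂ Γ₁⁻¹` implements `E₂ E₁⁻¹`
  have hM : Implements (localSchrodinger F N T v) (ofSymplectic _ (E₂ * E₁⁻¹)) (Γ₂ * Γ₁⁻¹) := by
    rw [_root_.map_mul, map_inv]
    exact Implements.mul _ hΓ₂ (Implements.inv _ hΓ₁)
  -- `E₂ E₁⁻¹` stabilises `ℓ_Y` elementwise
  have hsY : ∀ y : Fin N → v.adicCompletion F, ∃ y' : Fin N → v.adicCompletion F,
      (ofSymplectic _ (E₂ * E₁⁻¹)).act (inY (localPairing F N T v) y) = inY (localPairing F N T v) y' := by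
    intro y
    have hy : ((0 : Fin N → v.adicCompletion F), y) ∈ lagrangianY F N v :=
      Submodule.mem_prod.2 ⟨(Submodule.mem_bot _).2 rfl, Submodule.mem_top⟩
    rw [← hE₁] at hy
    obtain ⟨x, hx, hxy⟩ := Submodule.mem_map.1 hy
    have hx₂ : toLin F v E₂ x ∈ lagrangianY F N v := hE₂ ▸ Submodule.mem_map_of_mem hx
    have h0 : (toLin F v E₂ x).1 = 0 := (Submodule.mem_bot _).1 (Submodule.mem_prod.1 hx₂).1
    refine ⟨(toLin F v E₂ x).2, act_ofSymplectic_inY_eq _ ?_⟩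
    have hx₁ : (E₁ : ((Fin N → v.adicCompletion F) × (Fin N → v.adicCompletion F)) ≃ₗ[v.adicCompletion F]
        ((Fin N → v.adicCompletion F) × (Fin N → v.adicCompletion F))).symm ((0 : Fin N → v.adicCompletion F), y) = x := by
      rw [LinearEquiv.symm_apply_eq]
      exact hxy.symm
    change ((E₂ : ((Fin N → v.adicCompletion F) × (Fin N → v.adicCompletion F)) ≃ₗ[v.adicCompletion F]
        ((Fin N → v.adicCompletion F) × (Fin N → v.adicCompletion F))) *
      (E₁ : ((Fin N → v.adicCompletion F) × (Fin N → v.adicCompletion F)) ≃ₗ[v.adicCompletion F]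
        ((Fin N → v.adicCompletion F) × (Fin N → v.adicCompletion F)))⁻¹) ((0 : Fin N → v.adicCompletion F), y) = _
    rw [LinearEquiv.mul_apply, LinearEquiv.coe_inv, hx₁]
    exact Prod.ext h0 rfl
  obtain ⟨κ, hκ⟩ := exists_apply_zero_comp_implementer_eq_mul (localGram F N T v) hTv
    (isLocallyConstant_of_isContinuousNontrivial hψ) (continuous_toLinearMap₂'_left (localGram F N T v)) hψ hM hsY
  refine ⟨κ, fun Ψ => ?_⟩
  have h := hκ Ψ
  rw [LinearEquiv.mul_apply, LinearEquiv.coe_inv] at h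
  exact h

end Generic

/-! ## The CM doubled setting: binders -/

section CM

variable (L : Type) [Field L] [NumberField L] [IsCMField L] (v : HeightOneSpectrum (𝓞 (maximalRealSubfield L)))
  [MeasurableSpace (v.adicCompletion (maximalRealSubfield L))] [BorelSpace (v.adicCompletion (maximalRealSubfield L))]
  (μ : Measure (v.adicCompletion (maximalRealSubfield L))) [μ.IsAddHaarMeasure]
  (n : ℕ) {T₀ : Matrix (Fin n) (Fin n) (maximalRealSubfield L)} (hT₀ : T₀.IsSymm) (hT₀d : IsUnit T₀.det)
  {JD : Matrix (Fin (n + n)) (Fin (n + n)) L}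
  (hJD : JD = (gramD (maximalRealSubfield L) n T₀).map (algebraMap (maximalRealSubfield L) L))
  (hTv : IsUnit (localGram (maximalRealSubfield L) (n + n) (gramD (maximalRealSubfield L) n T₀) v).det)

/-! ### §1 (continued): the Siegel–Weil section changes by ONE scalar under a change of `m₀` -/

omit [MeasurableSpace (v.adicCompletion (maximalRealSubfield L))] [BorelSpace (v.adicCompletion (maximalRealSubfield L))] in
include hTv in
set_option maxHeartbeats 4000000 in -- the metaplectic pair carrier `MpPsi (localSchrodinger …)` unfolds slowly (as ★ D-A `swSectionLoc_mul_right`, ★ #7b)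
/-- **THE SIEGEL–WEIL SECTION IS BLIND TO THE CHOICE OF THE MOVER-IMPLEMENTER `m₀`, UP TO ONE SCALAR**: for ANY splitting `s` and two
implementers `m₀, m₀′ ∈ S̃p_ψ(𝕎^𝔻_v)` whose projections carry a common `ℓ` onto `ℓ_Y`: `∃ κ, ∀ Φ h, F^{m₀′}_Φ(h) = κ · F^{m₀}_Φ(h)` (so ★ S1-F1
`localSWImage` for `m₀′` lies in the one for `m₀`, and conversely by symmetry). [cite: MoeglinVignerasWaldspurger1987, Chap. 2 II.1 (A), II.6]
[cite: KudlaRallis1994, §1] -/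
theorem exists_swSectionLoc_moverChange
    (s : UnitaryGroup.localPi L (IsCMField.complexConj L) (n + n) JD v →*
      LocalMp (maximalRealSubfield L) (n + n) (gramD (maximalRealSubfield L) n T₀) v)
    (ℓ : Submodule (v.adicCompletion (maximalRealSubfield L))
      ((Fin (n + n) → v.adicCompletion (maximalRealSubfield L)) × (Fin (n + n) → v.adicCompletion (maximalRealSubfield L))))
    (m₀ m₀' : LocalMp (maximalRealSubfield L) (n + n) (gramD (maximalRealSubfield L) n T₀) v)
    (hm₀ : ℓ.map (toLin (maximalRealSubfield L) v (MpPsi.proj _ m₀)) = lagrangianY (maximalRealSubfield L) (n + n) v)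
    (hm₀' : ℓ.map (toLin (maximalRealSubfield L) v (MpPsi.proj _ m₀')) = lagrangianY (maximalRealSubfield L) (n + n) v) :
    ∃ κ : ℂ, ∀ (Φ : SchwartzBruhat (Fin (n + n) → v.adicCompletion (maximalRealSubfield L)))
      (h : UnitaryGroup.localPi L (IsCMField.complexConj L) (n + n) JD v),
      swSectionLoc L v s m₀' Φ h = κ * swSectionLoc L v s m₀ Φ h := by
  obtain ⟨κ, hκ⟩ := exists_apply_zero_moverChange_eq_mul (maximalRealSubfield L) v (n + n) (gramD (maximalRealSubfield L) n T₀) hTv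
    ℓ (MpPsi.proj _ m₀) (MpPsi.proj _ m₀') hm₀ hm₀' (MpPsi.toOp _ m₀) (MpPsi.toOp _ m₀') (MpPsi.toRep_implements _ m₀)
    (MpPsi.toRep_implements _ m₀')
  refine ⟨κ, fun Φ h => ?_⟩
  have key := hκ (MpPsi.toOp _ m₀
    (MpPsi.toRep (localSchrodinger (maximalRealSubfield L) (n + n) (gramD (maximalRealSubfield L) n T₀) v) (s h) Φ))
  rw [LinearEquiv.symm_apply_apply] at key
  unfold swSectionLoc
  rw [rep_mul_apply (MpPsi.toRep (localSchrodinger (maximalRealSubfield L) (n + n) (gramD (maximalRealSubfield L) n T₀) v)) m₀' (s h) Φ,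
    rep_mul_apply (MpPsi.toRep (localSchrodinger (maximalRealSubfield L) (n + n) (gramD (maximalRealSubfield L) n T₀) v)) m₀ (s h) Φ]
  exact key

/-! ## §2 The exact unipotent word through any mover-implementer -/

section Datum

variable {hTd' : IsUnit (gramD (maximalRealSubfield L) n T₀).det}
  {ℓ : Submodule (v.adicCompletion (maximalRealSubfield L))
    ((Fin (n + n) → v.adicCompletion (maximalRealSubfield L)) × (Fin (n + n) → v.adicCompletion (maximalRealSubfield L)))}
  {hℓ : LinearMap.BilinForm.orthogonal (alt (polar (localPairing (maximalRealSubfield L) (n + n) (gramD (maximalRealSubfield L) n T₀) v))) ℓ = ℓ}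
  (D : LocalSplittingDatum (maximalRealSubfield L) L (IsCMField.complexConj L) (n + n) (complexConj_imagUnit L) (imagUnit_ne_zero L)
    (imagUnit_mul_self L) (gramD (maximalRealSubfield L) n T₀) (gramD_isSymm (maximalRealSubfield L) n hT₀) hTd' hJD v μ ℓ hℓ)
  (E' : LocalSp (maximalRealSubfield L) (n + n) (gramD (maximalRealSubfield L) n T₀) v)
  (hE' : (deltaLagrangian (maximalRealSubfield L) v n).map (toLin (maximalRealSubfield L) v E') = lagrangianY (maximalRealSubfield L) (n + n) v)
  (Γ : SchwartzBruhat (Fin (n + n) → v.adicCompletion (maximalRealSubfield L)) ≃ₗ[ℂ]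
    SchwartzBruhat (Fin (n + n) → v.adicCompletion (maximalRealSubfield L)))
  (hΓ : Implements (localSchrodinger (maximalRealSubfield L) (n + n) (gramD (maximalRealSubfield L) n T₀) v) (ofSymplectic _ E') Γ)

include hT₀d hE' hΓ in
set_option maxHeartbeats 4000000 in -- the metaplectic pair carrier `MpPsi (localSchrodinger …)` unfolds slowly (as ★ D-A `swSectionLoc_mul_right`, ★ #7b)
/-- **THE EXACT UNIPOTENT WORD `Γ (ω_D(n(t)) Ψ) = unipOpPi c_t (Γ Ψ)` THROUGH ANY MOVER-IMPLEMENTER `(E, Γ)`**, `c_t = cOfFix 𝕋 (E ι(n(t)) E⁻¹)`,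
for a local splitting datum `D` whose PARABOLIC NORMALISATION AT THE UNIPOTENT `n(t)` holds through `Γ` by value
(`hpar : (Γ (ω_D(n(t)) (Γ⁻¹ Φ)))(0) = Φ(0)`; for the CM datum see `parabolicAtUnipotents_localSplittingDatumCM`): both sides agree up to a unit by ★
`exists_section_iotaD_nElem_apply_eq_smul_conj_unipOpPi` and `ω_D = β⁻¹ • r ∘ ι`, and the unit is `1` because `(unipOpPi c f)(0) = f(0)` and `1_{𝒪}(0) ≠ 0`.
[cite: Kudla1994, §3 Thm. 3.1] [cite: Rangarao1993, Lemma 3.2 (3.8), p. 351, Thm. 3.5] [cite: MoeglinVignerasWaldspurger1987, Chap. 2 II.1 (A), II.6] -/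
theorem implementer_localOmega_nElem_apply
    (t : Matrix (Fin n) (Fin n) (LocalRing L v))
    (ht : (t.map (conjLocal L (IsCMField.complexConj L) v))ᵀ * gramS (maximalRealSubfield L) L v n T₀ +
      gramS (maximalRealSubfield L) L v n T₀ * t = 0)
    (hpar : ∀ Φ : SchwartzBruhat (Fin (n + n) → v.adicCompletion (maximalRealSubfield L)),
      ((Γ (D.localOmega (nElem (maximalRealSubfield L) L (IsCMField.complexConj L) v n hJD t ht) (Γ.symm Φ)) :
          SchwartzBruhat (Fin (n + n) → v.adicCompletion (maximalRealSubfield L))) :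
            (Fin (n + n) → v.adicCompletion (maximalRealSubfield L)) → ℂ) 0 =
        ((Φ : SchwartzBruhat (Fin (n + n) → v.adicCompletion (maximalRealSubfield L))) :
          (Fin (n + n) → v.adicCompletion (maximalRealSubfield L)) → ℂ) 0)
    (Ψ : SchwartzBruhat (Fin (n + n) → v.adicCompletion (maximalRealSubfield L))) :
    Γ (D.localOmega (nElem (maximalRealSubfield L) L (IsCMField.complexConj L) v n hJD t ht) Ψ) =
      unipOpPi (isLocallyConstant_of_isContinuousNontrivial (isContinuousNontrivial_adeleAddCharAt (maximalRealSubfield L) v))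
        (Matrix.mulVecLin (cOfFix (localGram (maximalRealSubfield L) (n + n) (gramD (maximalRealSubfield L) n T₀) v)
          (E' * iotaD (maximalRealSubfield L) L (IsCMField.complexConj L) (complexConj_imagUnit L) (imagUnit_ne_zero L)
            (imagUnit_mul_self L) v n hT₀ hJD (nElem (maximalRealSubfield L) L (IsCMField.complexConj L) v n hJD t ht) * E'⁻¹))) (Γ Ψ) := by
  obtain ⟨γ₀, hγ₀⟩ := exists_section_iotaD_nElem_apply_eq_smul_conj_unipOpPi (maximalRealSubfield L) L (IsCMField.complexConj L)
    (complexConj_imagUnit L) (imagUnit_ne_zero L) (imagUnit_mul_self L) v n hT₀ hT₀d hJD D.hU D.r E' hE' Γ hΓ t ht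
  -- the word up to the scalar `c₀ := β(n(t))⁻¹ γ₀`
  have hω : ∀ Φ : SchwartzBruhat (Fin (n + n) → v.adicCompletion (maximalRealSubfield L)),
      Γ (D.localOmega (nElem (maximalRealSubfield L) L (IsCMField.complexConj L) v n hJD t ht) Φ) =
        ((((D.beta (nElem (maximalRealSubfield L) L (IsCMField.complexConj L) v n hJD t ht))⁻¹ : ℂˣ) : ℂ) * (γ₀ : ℂ)) •
          unipOpPi (isLocallyConstant_of_isContinuousNontrivial (isContinuousNontrivial_adeleAddCharAt (maximalRealSubfield L) v))
            (Matrix.mulVecLin (cOfFix (localGram (maximalRealSubfield L) (n + n) (gramD (maximalRealSubfield L) n T₀) v)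
              (E' * iotaD (maximalRealSubfield L) L (IsCMField.complexConj L) (complexConj_imagUnit L) (imagUnit_ne_zero L)
                (imagUnit_mul_self L) v n hT₀ hJD (nElem (maximalRealSubfield L) L (IsCMField.complexConj L) v n hJD t ht) * E'⁻¹))) (Γ Φ) := by
    intro Φ
    rw [D.localOmega_apply, hγ₀ Φ, Units.smul_def, LinearEquiv.map_smul, LinearEquiv.map_smul, LinearEquiv.apply_symm_apply, smul_smul]
  -- the value at `0` of `unipOpPi c f` is `f 0`
  have hU0 : ∀ (c' : (Fin (n + n) → v.adicCompletion (maximalRealSubfield L)) →ₗ[v.adicCompletion (maximalRealSubfield L)]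
        (Fin (n + n) → v.adicCompletion (maximalRealSubfield L))) (f : SchwartzBruhat (Fin (n + n) → v.adicCompletion (maximalRealSubfield L))),
      ((unipOpPi (isLocallyConstant_of_isContinuousNontrivial (isContinuousNontrivial_adeleAddCharAt (maximalRealSubfield L) v)) c' f :
          SchwartzBruhat (Fin (n + n) → v.adicCompletion (maximalRealSubfield L))) :
            (Fin (n + n) → v.adicCompletion (maximalRealSubfield L)) → ℂ) 0 =
        (f : (Fin (n + n) → v.adicCompletion (maximalRealSubfield L)) → ℂ) 0 := by
    intro c' f
    rw [coe_unipOpPi_apply, halfForm_apply, zero_dotProduct, mul_zero, neg_zero, AddChar.map_zero_eq_one, Circle.coe_one, one_mul]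
  -- the scalar is `1`: test against `Φ₀ := 1_{𝒪}` through `Γ⁻¹`
  have hc : (((D.beta (nElem (maximalRealSubfield L) L (IsCMField.complexConj L) v n hJD t ht))⁻¹ : ℂˣ) : ℂ) * (γ₀ : ℂ) = 1 := by
    have h0 : ((unitVec (maximalRealSubfield L) (Fin (n + n)) v : SchwartzBruhat (Fin (n + n) → v.adicCompletion (maximalRealSubfield L))) :
        (Fin (n + n) → v.adicCompletion (maximalRealSubfield L)) → ℂ) 0 = 1 :=
      unitVec_apply_of_mem (zero_mem_integralBox (maximalRealSubfield L) (Fin (n + n)) v)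
    have h1 := hpar (unitVec (maximalRealSubfield L) (Fin (n + n)) v)
    rw [hω (Γ.symm (unitVec (maximalRealSubfield L) (Fin (n + n)) v)), LinearEquiv.apply_symm_apply, Submodule.coe_smul, Pi.smul_apply,
      smul_eq_mul, hU0, h0, mul_one] at h1
    exact h1
  rw [hω Ψ, hc, one_smul]

/-! ## §3 The Weyl word, up to a unit -/

include hΓ in
/-- **`ω_D(w_Δ) = γ • Γ⁻¹ ∘ 𝓕 ∘ leviOpPi B′ ∘ Γ` for a unit `γ`**, given the Weyl conjugation `hW : E ι(w_Δ) E⁻¹ = J_𝕋⁻¹ · m(B′)` (discharged for the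
Cayley mover by ★ `exists_mover_conj_iotaD_weylDelta`): ★ `leraySection_deltaLagrangian_apply_eq_smul_conj_fourierOpPi_leviOpPi` with `β(w_Δ)⁻¹` folded
into `γ`. [cite: Weil1964, n° 13 (16), (29), p. 160] [cite: MoeglinVignerasWaldspurger1987, Chap. 2 II.1 (A), II.6] [cite: Kudla1994, §3 Thm. 3.1] -/
theorem exists_localOmega_weylDelta_apply_eq_smul (B' : GL (Fin (n + n)) (v.adicCompletion (maximalRealSubfield L)))
    (hW : E' * iotaD (maximalRealSubfield L) L (IsCMField.complexConj L) (complexConj_imagUnit L) (imagUnit_ne_zero L)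
        (imagUnit_mul_self L) v n hT₀ hJD (weylDelta (maximalRealSubfield L) L (IsCMField.complexConj L) v n hJD) * E'⁻¹ =
      (transportSp (localGram (maximalRealSubfield L) (n + n) (gramD (maximalRealSubfield L) n T₀) v) hTv (SymplecticGroup.symJ _ _))⁻¹ *
        transportSp (localGram (maximalRealSubfield L) (n + n) (gramD (maximalRealSubfield L) n T₀) v) hTv (levi B'))
    {m : ℤ} (hm : (adeleAddCharAt (maximalRealSubfield L) v).HasConductorExp m) :
    ∃ γ : ℂˣ, ∀ Φ : SchwartzBruhat (Fin (n + n) → v.adicCompletion (maximalRealSubfield L)),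
      D.localOmega (weylDelta (maximalRealSubfield L) L (IsCMField.complexConj L) v n hJD) Φ =
        (γ : ℂ) • Γ.symm (fourierOpPi μ (isContinuousNontrivial_adeleAddCharAt (maximalRealSubfield L) v) hm
          (leviOpPi (glEquiv B') (Γ Φ))) := by
  obtain ⟨γ, hγ⟩ := leraySection_deltaLagrangian_apply_eq_smul_conj_fourierOpPi_leviOpPi (maximalRealSubfield L) (n + n)
    (gramD (maximalRealSubfield L) n T₀) v μ hTv D.hU D.r E' Γ hΓ
    (iotaD (maximalRealSubfield L) L (IsCMField.complexConj L) (complexConj_imagUnit L) (imagUnit_ne_zero L)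
      (imagUnit_mul_self L) v n hT₀ hJD (weylDelta (maximalRealSubfield L) L (IsCMField.complexConj L) v n hJD)) B' hW hm
  refine ⟨(D.beta (weylDelta (maximalRealSubfield L) L (IsCMField.complexConj L) v n hJD))⁻¹ * γ, fun Φ => ?_⟩
  rw [D.localOmega_apply, hγ Φ, Units.smul_def, smul_smul, Units.val_mul]

end Datum

/-! ## §2 (continued) The parabolic normalisation at the unipotents for the CM datum -/


/-- **THE PARABOLIC NORMALISATION AT THE UNIPOTENTS FOR THE CM DATUM, THROUGH ANY MOVER-IMPLEMENTER**: for Kudla's splitting `D := localSplittingDatumCM`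
of the doubled unitary group at `v` (split or not), any mover `E` (`E ℓ_Δ = ℓ_Y`) and any implementer `Γ` of `E`: `(Γ (ω_D(n(t)) (Γ⁻¹ Φ)))(0) = Φ(0)` —
★ `localSplittingDatumCM_parabolic` at `p = n(t)` (`χ_v(det_Δ n(t)) = 1`, `|det_Δ n(t)| = 1` by ★ `detDelta_nElem`), transported from `r(E)` to `Γ = κ • r(E)`.
[cite: HarrisKudlaSweet1996, §1 (1.15)–(1.16)] [cite: Kudla1994, §3 Thm. 3.1] [cite: MoeglinVignerasWaldspurger1987, Chap. 2 II.1 (A)] -/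
theorem parabolicAtUnipotents_localSplittingDatumCM (χ : HeckeCharacter L) (hχ : IsSplittingChar L 1 χ)
    (E' : LocalSp (maximalRealSubfield L) (n + n) (gramD (maximalRealSubfield L) n T₀) v)
    (hE' : (deltaLagrangian (maximalRealSubfield L) v n).map (toLin (maximalRealSubfield L) v E') = lagrangianY (maximalRealSubfield L) (n + n) v)
    (Γ : SchwartzBruhat (Fin (n + n) → v.adicCompletion (maximalRealSubfield L)) ≃ₗ[ℂ]
      SchwartzBruhat (Fin (n + n) → v.adicCompletion (maximalRealSubfield L)))
    (hΓ : Implements (localSchrodinger (maximalRealSubfield L) (n + n) (gramD (maximalRealSubfield L) n T₀) v) (ofSymplectic _ E') Γ)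
    (t : Matrix (Fin n) (Fin n) (LocalRing L v))
    (ht : (t.map (conjLocal L (IsCMField.complexConj L) v))ᵀ * gramS (maximalRealSubfield L) L v n T₀ +
      gramS (maximalRealSubfield L) L v n T₀ * t = 0)
    (Φ : SchwartzBruhat (Fin (n + n) → v.adicCompletion (maximalRealSubfield L))) :
    ((Γ ((localSplittingDatumCM L v μ n hT₀ hT₀d hJD χ hχ).localOmega (nElem (maximalRealSubfield L) L (IsCMField.complexConj L) v n hJD t ht)
        (Γ.symm Φ)) : SchwartzBruhat (Fin (n + n) → v.adicCompletion (maximalRealSubfield L))) :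
          (Fin (n + n) → v.adicCompletion (maximalRealSubfield L)) → ℂ) 0 =
      ((Φ : SchwartzBruhat (Fin (n + n) → v.adicCompletion (maximalRealSubfield L))) :
        (Fin (n + n) → v.adicCompletion (maximalRealSubfield L)) → ℂ) 0 := by
  -- the parabolic law through the datum's own implementer `r(E)`
  have h8 := localSplittingDatumCM_parabolic L v μ n hT₀ hT₀d hJD χ hχ E' hE'
    (nElem (maximalRealSubfield L) L (IsCMField.complexConj L) v n hJD t ht)
    (isSiegelDelta_nElem (maximalRealSubfield L) L (IsCMField.complexConj L) (complexConj_imagUnit L) (imagUnit_ne_zero L)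
      (imagUnit_mul_self L) v n hT₀ hJD t ht) Φ
  have hdet : ∀ w : UnitaryGroup.PlacesOver L v,
      detDelta (maximalRealSubfield L) L (IsCMField.complexConj L) v n w (nElem (maximalRealSubfield L) L (IsCMField.complexConj L) v n hJD t ht) = 1 :=
    detDelta_nElem (maximalRealSubfield L) L (IsCMField.complexConj L) v n hJD t ht
  have hprod : (∏ w' : UnitaryGroup.PlacesOver L v,
      Real.sqrt ‖detDelta (maximalRealSubfield L) L (IsCMField.complexConj L) v n w'
        (nElem (maximalRealSubfield L) L (IsCMField.complexConj L) v n hJD t ht)‖) = 1 :=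
    Finset.prod_eq_one fun w' _ => by rw [hdet w', norm_one, Real.sqrt_one]
  rw [chiDet_eq_one_of_detDelta_eq_one (maximalRealSubfield L) L (IsCMField.complexConj L) v n _ _ hdet, inv_one, Units.val_one, one_mul,
    hprod, Complex.ofReal_one, one_mul] at h8
  -- transport from `r(E)` to `Γ = κ • r(E)`
  obtain ⟨κ, hκ⟩ := (localSplittingDatumCM L v μ n hT₀ hT₀d hJD χ hχ).hU E' ((localSplittingDatumCM L v μ n hT₀ hT₀d hJD χ hχ).r E') Γ
    ((localSplittingDatumCM L v μ n hT₀ hT₀d hJD χ hχ).r.implements E') hΓ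
  have hsymm : Γ.symm Φ = ((localSplittingDatumCM L v μ n hT₀ hT₀d hJD χ hχ).r E').symm (((κ⁻¹ : ℂˣ) : ℂ) • Φ) := by
    rw [LinearEquiv.symm_apply_eq, hκ, LinearEquiv.apply_symm_apply, smul_smul, ← Units.val_mul, mul_inv_cancel, Units.val_one, one_smul]
  rw [hsymm, LinearEquiv.map_smul, LinearMap.map_smul, LinearEquiv.map_smul, hκ, smul_smul, ← Units.val_mul, inv_mul_cancel, Units.val_one,
    one_smul]
  exact h8

/-! ## §4 Non-vanishing: the section at a point, and `κ ≠ 0` in the change of `m₀` -/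

omit [MeasurableSpace (v.adicCompletion (maximalRealSubfield L))] [BorelSpace (v.adicCompletion (maximalRealSubfield L))] in
/-- **`Φ ↦ F_Φ(h)` is not identically zero at any `h`**, for ANY splitting `s` and ANY `m₀ ∈ S̃p_ψ(𝕎^𝔻_v)`: `ω(m₀ · s h)` is invertible and `1_{𝒪}(0) = 1`
(★ `apply_zero_toRep_ne_zero`).  Turns every «`F_Φ(h) = γ · X(Φ)` for all `Φ`» into `γ ≠ 0`. [cite: MoeglinVignerasWaldspurger1987, Chap. 2 II.1 (B)] [cite: KudlaRallis1994, §1] -/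
theorem exists_swSectionLoc_ne_zero
    (s : UnitaryGroup.localPi L (IsCMField.complexConj L) (n + n) JD v →*
      LocalMp (maximalRealSubfield L) (n + n) (gramD (maximalRealSubfield L) n T₀) v)
    (m₀ : LocalMp (maximalRealSubfield L) (n + n) (gramD (maximalRealSubfield L) n T₀) v)
    (h : UnitaryGroup.localPi L (IsCMField.complexConj L) (n + n) JD v) :
    ∃ Φ : SchwartzBruhat (Fin (n + n) → v.adicCompletion (maximalRealSubfield L)), swSectionLoc L v s m₀ Φ h ≠ 0 :=
  apply_zero_toRep_ne_zero (maximalRealSubfield L) (n + n) (gramD (maximalRealSubfield L) n T₀) v (m₀ * s h)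

omit [MeasurableSpace (v.adicCompletion (maximalRealSubfield L))] [BorelSpace (v.adicCompletion (maximalRealSubfield L))] in
include hTv in
/-- `exists_swSectionLoc_moverChange` with **`κ ≠ 0`** (the organ lead's letter, DESIGN-W3-v2 §0 Q2: «`γ ≠ 0` must be part of the statement»): the scalar relating the
Siegel–Weil sections of two mover-implementers is non-zero, `Φ ↦ F^{m₀′}_Φ(1)` being non-zero (`exists_swSectionLoc_ne_zero`). [cite: MoeglinVignerasWaldspurger1987, Chap. 2 II.1 (A)–(B), II.6]
[cite: KudlaRallis1994, §1] -/
theorem exists_ne_zero_swSectionLoc_moverChange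
    (s : UnitaryGroup.localPi L (IsCMField.complexConj L) (n + n) JD v →*
      LocalMp (maximalRealSubfield L) (n + n) (gramD (maximalRealSubfield L) n T₀) v)
    (ℓ : Submodule (v.adicCompletion (maximalRealSubfield L))
      ((Fin (n + n) → v.adicCompletion (maximalRealSubfield L)) × (Fin (n + n) → v.adicCompletion (maximalRealSubfield L))))
    (m₀ m₀' : LocalMp (maximalRealSubfield L) (n + n) (gramD (maximalRealSubfield L) n T₀) v)
    (hm₀ : ℓ.map (toLin (maximalRealSubfield L) v (MpPsi.proj _ m₀)) = lagrangianY (maximalRealSubfield L) (n + n) v)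
    (hm₀' : ℓ.map (toLin (maximalRealSubfield L) v (MpPsi.proj _ m₀')) = lagrangianY (maximalRealSubfield L) (n + n) v) :
    ∃ κ : ℂ, κ ≠ 0 ∧ ∀ (Φ : SchwartzBruhat (Fin (n + n) → v.adicCompletion (maximalRealSubfield L)))
      (h : UnitaryGroup.localPi L (IsCMField.complexConj L) (n + n) JD v),
      swSectionLoc L v s m₀' Φ h = κ * swSectionLoc L v s m₀ Φ h := by
  obtain ⟨κ, hκ⟩ := exists_swSectionLoc_moverChange L v n hTv s ℓ m₀ m₀' hm₀ hm₀'
  refine ⟨κ, fun h0 => ?_, hκ⟩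
  obtain ⟨Φ, hΦ⟩ := exists_swSectionLoc_ne_zero L v n s m₀' 1
  exact hΦ (by rw [hκ Φ 1, h0, zero_mul])

end CM

end Summit.HodgeConjecture.HodgeConjecture.Cruxes.HLiu418.K2LiuLocalSWBigCellWords

end
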